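import Literature.AnabelianGeometry.EtaleTheta.SettingBridge
import Literature.AnabelianGeometry.EtaleTheta.ThetaQuotientFacts
import HarnessLib

/-!
# [EtTh] §1 setting: the root's abstract theta quotients versus the constructed ones

Mochizuki, *The étale theta function and its Frobenioid-theoretic manifestations*, Publ. RIMS **45**
(2009), §1, PRIMS PDF p. 12 (printed 238): "`Π^tp_X ↠ (Π^tp_X)^Θ ↠ (Π^tp_X)^ell` … the quotients
whose kernels are the kernels of the quotients `Δ^tp_X ↠ (Δ^tp_X)^Θ ↠ (Δ^tp_X)^ell`" induced by
"`Δ_X ↠ Δ^Θ_X := Δ_X/[Δ_X,[Δ_X,Δ_X]] ↠ Δ^ell_X := Δ^ab_X`" [cite: MochizukiEtTh2009, §1 p.12].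

Cell abc-iut, unit W2-L2-03 (merge adapter), last piece. The [EtTh] §1 root
(`EtaleTheta/Setting.lean`, seat abc-iut-L2-t1) carries the theta quotients as ABSTRACT data: types
`GtpTheta`, `GtpEll` with homomorphisms `toTheta`, `thetaToEll` and the printed kernels as axioms
(`ker_toTheta`, `ker_toEll`). The group-level interface (`SemiGraphs/TemperedThetaQuotients.lean`,
seat abc-iut-L3-t2) CONSTRUCTS them: `PiTheta = Π^tp_X/thetaKer`, `PiEll`, `piThetaToEll`. Through the
once-punctured bridge `ThetaSetting.toOncePuncturedTemperedGroup` (`SettingBridge.lean`) both live on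
the same group `Π^tp_X`, and this file identifies them:

* `thetaKer_bridge`, `ellKer_bridge` — the constructed kernels ARE the root's kernels
  (`thetaKer = Ker(toTheta)`, `ellKer = Ker(thetaToEll ∘ toTheta)`; uses `ThetaQuotientFacts` and the
  root axioms `ker_toTheta`/`ker_toEll`, the two bracket conventions `[[Δ,Δ],Δ]` vs `[Δ,[Δ,Δ]]`
  agreeing);
* `thetaQuotientEquiv : PiTheta ≃* D.GtpTheta`, `ellQuotientEquiv : PiEll ≃* D.GtpEll` — the
  canonical group isomorphisms, compatible with the projections (`thetaQuotientEquiv_mk`,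
  `ellQuotientEquiv_mk`) and with `(Π^tp_X)^Θ ↠ (Π^tp_X)^ell` (`ellQuotientEquiv_piThetaToEll`), and
  CONTINUOUS (`continuous_thetaQuotientEquiv`; the root does not assert that `toTheta` is a quotient
  map, so continuity of the inverse is not claimed);
* `map_thetaQuotientEquiv_ker` — the kernel of `piThetaToEll` is carried onto the root's
  `Δ_Θ = DeltaTheta`, and `map_thetaQuotientEquiv_deltaTpTheta` — `(Δ^tp_X)^Θ` onto `Dtp.map toTheta`.
Consequently the root's fields `ker_thetaToEll_comm` / `ker_thetaToEll_central` are RECOVERED from the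
group-level theorems (`ker_thetaToEll_comm_of_bridge`, `ker_thetaToEll_central_of_bridge`): they were
consistent transcriptions, now visibly redundant given the bridge parameters. Nothing here asserts
that such data exist for an actual curve; typed ≠ endorsed; no side is taken on any disputed claim.
-/

noncomputable section

open scoped commutatorElement

namespace Literature.AnabelianGeometry.EtaleTheta

open Literature.AnabelianGeometry.SemiGraphs

namespace ThetaSetting

variable {p : ℕ} [Fact p.Prime] {D : ThetaSetting p} (e : D.OncePuncturedData)

/-! ### The root's projections, read on the bridge's copy of `Π^tp_X` -/

/-- The root's `toTheta : Π^tp_X ↠ (Π^tp_X)^Θ`, as a homomorphism out of the bridge's (definitionally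
equal) copy of `Π^tp_X` — so that kernels and quotients are compared inside one instance context.
[cite: MochizukiEtTh2009, §1 p.12] -/
def toThetaB : (D.toOncePuncturedTemperedGroup e).Pi →* D.GtpTheta := D.toTheta

/-- `toThetaB` is `toTheta`. [cite: MochizukiEtTh2009, §1 p.12] -/
@[simp] theorem toThetaB_apply (g : D.PiTemp) : toThetaB e g = D.toTheta g := rfl

/-- The root's `thetaToEll ∘ toTheta : Π^tp_X ↠ (Π^tp_X)^ell` out of the bridge's copy of `Π^tp_X`.
[cite: MochizukiEtTh2009, §1 p.12] -/
def toEllB : (D.toOncePuncturedTemperedGroup e).Pi →* D.GtpEll := D.thetaToEll.comp D.toTheta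

/-- `toEllB` is `thetaToEll ∘ toTheta`. [cite: MochizukiEtTh2009, §1 p.12] -/
@[simp] theorem toEllB_apply (g : D.PiTemp) : toEllB e g = D.thetaToEll (D.toTheta g) := rfl

/-! ### The kernels agree -/

/-- The constructed `Ker(Π^tp_X ↠ (Π^tp_X)^Θ)` of the bridge is the root's `Ker(toTheta)`
(both are the pull-back of `[Δ_X,[Δ_X,Δ_X]]⁻ = [[Δ_X,Δ_X],Δ_X]⁻`, p. 12). [cite: MochizukiEtTh2009, §1 p.12] -/
theorem thetaKer_bridge : (D.toOncePuncturedTemperedGroup e).thetaKer = (toThetaB e).ker := by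
  rw [ThetaQuotientFacts.thetaKer_eq_comap]
  change ((⁅(D.toOncePuncturedTemperedGroup e).deltaHat,
      ⁅(D.toOncePuncturedTemperedGroup e).deltaHat, (D.toOncePuncturedTemperedGroup e).deltaHat⁆⁆
      ).topologicalClosure).comap D.toHat.toMonoidHom = D.toTheta.ker
  rw [toOncePuncturedTemperedGroup_deltaHat, D.ker_toTheta,
    Subgroup.commutator_comm ⁅D.DeltaHat, D.DeltaHat⁆ D.DeltaHat]
  rfl

/-- The constructed `Ker(Π^tp_X ↠ (Π^tp_X)^ell)` of the bridge is the root's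
`Ker(thetaToEll ∘ toTheta)` (pull-back of `[Δ_X,Δ_X]⁻`, p. 12). [cite: MochizukiEtTh2009, §1 p.12] -/
theorem ellKer_bridge : (D.toOncePuncturedTemperedGroup e).ellKer = (toEllB e).ker := by
  rw [ThetaQuotientFacts.ellKer_eq_comap]
  change ((⁅(D.toOncePuncturedTemperedGroup e).deltaHat, (D.toOncePuncturedTemperedGroup e).deltaHat⁆
      ).topologicalClosure).comap D.toHat.toMonoidHom = (D.thetaToEll.comp D.toTheta).ker
  rw [toOncePuncturedTemperedGroup_deltaHat, D.ker_toEll]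
  rfl

/-! ### The canonical isomorphisms -/

/-- **`(Π^tp_X)^Θ` constructed `≃` `(Π^tp_X)^Θ` of the root**: the canonical group isomorphism
`Π^tp_X/thetaKer ≃* GtpTheta` induced by `toTheta` (surjective with kernel `thetaKer`).
[cite: MochizukiEtTh2009, §1 p.12] -/
def thetaQuotientEquiv : (D.toOncePuncturedTemperedGroup e).PiTheta ≃* D.GtpTheta :=
  (QuotientGroup.quotientMulEquivOfEq (thetaKer_bridge e)).trans
    (QuotientGroup.quotientKerEquivOfSurjective (toThetaB e) D.toTheta_surjective)

/-- `thetaQuotientEquiv` is compatible with the projections: `[g] ↦ toTheta g`.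
[cite: MochizukiEtTh2009, §1 p.12] -/
theorem thetaQuotientEquiv_mk (g : D.PiTemp) :
    thetaQuotientEquiv e (QuotientGroup.mk' (D.toOncePuncturedTemperedGroup e).thetaKer g) =
      D.toTheta g := by
  rfl

/-- **`(Π^tp_X)^ell` constructed `≃` `(Π^tp_X)^ell` of the root**: the canonical group isomorphism
`Π^tp_X/ellKer ≃* GtpEll` induced by `thetaToEll ∘ toTheta`. [cite: MochizukiEtTh2009, §1 p.12] -/
def ellQuotientEquiv : (D.toOncePuncturedTemperedGroup e).PiEll ≃* D.GtpEll :=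
  (QuotientGroup.quotientMulEquivOfEq (ellKer_bridge e)).trans
    (QuotientGroup.quotientKerEquivOfSurjective (toEllB e)
      (D.thetaToEll_surjective.comp D.toTheta_surjective))

/-- `ellQuotientEquiv` is compatible with the projections: `[g] ↦ thetaToEll (toTheta g)`.
[cite: MochizukiEtTh2009, §1 p.12] -/
theorem ellQuotientEquiv_mk (g : D.PiTemp) :
    ellQuotientEquiv e (QuotientGroup.mk' (D.toOncePuncturedTemperedGroup e).ellKer g) =
      D.thetaToEll (D.toTheta g) := by
  rfl

/-- The two isomorphisms intertwine the constructed `(Π^tp_X)^Θ ↠ (Π^tp_X)^ell` with the root's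
`thetaToEll`. [cite: MochizukiEtTh2009, §1 p.12] -/
theorem ellQuotientEquiv_piThetaToEll (x : (D.toOncePuncturedTemperedGroup e).PiTheta) :
    ellQuotientEquiv e ((D.toOncePuncturedTemperedGroup e).piThetaToEll x) =
      D.thetaToEll (thetaQuotientEquiv e x) := by
  obtain ⟨g, rfl⟩ := QuotientGroup.mk'_surjective _ x
  rw [thetaQuotientEquiv_mk]
  exact ellQuotientEquiv_mk e g

/-- `thetaQuotientEquiv` is continuous (the quotient topology is final for the projection and
`toTheta` is continuous). The root does not assert that `toTheta` is a quotient map, so continuity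
of the inverse is not claimed. [cite: MochizukiEtTh2009, §1 p.12] -/
theorem continuous_thetaQuotientEquiv : Continuous (thetaQuotientEquiv e) := by
  refine (QuotientGroup.isQuotientMap_mk _).continuous_iff.mpr ?_
  have h : (⇑(thetaQuotientEquiv e) ∘ QuotientGroup.mk) = ⇑D.toTheta :=
    funext fun g => thetaQuotientEquiv_mk e g
  rw [h]
  exact D.continuous_toTheta

/-- `ellQuotientEquiv` is continuous. [cite: MochizukiEtTh2009, §1 p.12] -/
theorem continuous_ellQuotientEquiv : Continuous (ellQuotientEquiv e) := by
  refine (QuotientGroup.isQuotientMap_mk _).continuous_iff.mpr ?_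
  have h : (⇑(ellQuotientEquiv e) ∘ QuotientGroup.mk) = ⇑D.thetaToEll ∘ ⇑D.toTheta :=
    funext fun g => ellQuotientEquiv_mk e g
  rw [h]
  exact D.continuous_thetaToEll.comp D.continuous_toTheta

/-! ### Transport of `Δ_Θ` and `(Δ^tp_X)^Θ` -/

/-- `thetaQuotientEquiv` carries the kernel of the constructed `(Π^tp_X)^Θ ↠ (Π^tp_X)^ell` onto the
root's `Δ_Θ = Ker(thetaToEll)`. [cite: MochizukiEtTh2009, §1 p.12] -/
theorem map_thetaQuotientEquiv_ker :
    (D.toOncePuncturedTemperedGroup e).piThetaToEll.ker.map (thetaQuotientEquiv e).toMonoidHom =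
      D.DeltaTheta := by
  ext y
  constructor
  · rintro ⟨x, hx, rfl⟩
    have hx' : (D.toOncePuncturedTemperedGroup e).piThetaToEll x = 1 := hx
    change D.thetaToEll (thetaQuotientEquiv e x) = 1
    rw [← ellQuotientEquiv_piThetaToEll, hx', map_one]
  · intro hy
    have hy' : D.thetaToEll y = 1 := hy
    refine ⟨(thetaQuotientEquiv e).symm y, ?_, by simp⟩
    change (D.toOncePuncturedTemperedGroup e).piThetaToEll ((thetaQuotientEquiv e).symm y) = 1
    rw [← (ellQuotientEquiv e).injective.eq_iff, ellQuotientEquiv_piThetaToEll,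
      MulEquiv.apply_symm_apply, map_one]
    exact hy'

/-- `thetaQuotientEquiv` carries the constructed `(Δ^tp_X)^Θ` onto the root's `Dtp.map toTheta`.
[cite: MochizukiEtTh2009, §1 p.12] -/
theorem map_thetaQuotientEquiv_deltaTpTheta :
    (D.toOncePuncturedTemperedGroup e).deltaTpTheta.map (thetaQuotientEquiv e).toMonoidHom =
      D.DeltaTemp.map D.toTheta := by
  change (((D.toOncePuncturedTemperedGroup e).delta).map _).map _ = _
  rw [toOncePuncturedTemperedGroup_delta, Subgroup.map_map]
  ext y
  constructor
  · rintro ⟨g, hg, rfl⟩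
    exact ⟨g, hg, (thetaQuotientEquiv_mk e g).symm⟩
  · rintro ⟨g, hg, rfl⟩
    exact ⟨g, hg, thetaQuotientEquiv_mk e g⟩

/-! ### The root's centrality axioms recovered from the group-level theorems -/

/-- The root field `ker_thetaToEll_central` RECOVERED through the bridge from the group-level theorem
`ThetaQuotientFacts.ker_piThetaToEll_central` ("`1 → Δ_Θ → (Δ^tp_X)^Θ → (Δ^tp_X)^ell → 1`" is
central, p. 12) — showing the transcribed axiom is a consequence of the constructed quotients.
[cite: MochizukiEtTh2009, §1 p.12] -/
theorem ker_thetaToEll_central_of_bridge (e : D.OncePuncturedData) :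
    ∀ x ∈ D.thetaToEll.ker, ∀ y ∈ D.DeltaTemp.map D.toTheta, x * y = y * x := by
  intro x hx y hy
  have hx' : x ∈ (D.toOncePuncturedTemperedGroup e).piThetaToEll.ker.map
      (thetaQuotientEquiv e).toMonoidHom := by
    rw [map_thetaQuotientEquiv_ker]; exact hx
  have hy' : y ∈ (D.toOncePuncturedTemperedGroup e).deltaTpTheta.map
      (thetaQuotientEquiv e).toMonoidHom := by
    rw [map_thetaQuotientEquiv_deltaTpTheta]; exact hy
  obtain ⟨a, ha, rfl⟩ := hx'
  obtain ⟨b, hb, rfl⟩ := hy'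
  change thetaQuotientEquiv e a * thetaQuotientEquiv e b = thetaQuotientEquiv e b * thetaQuotientEquiv e a
  rw [← map_mul, ← map_mul, ThetaQuotientFacts.ker_piThetaToEll_central _ a ha b hb]

/-- The root field `ker_thetaToEll_comm` RECOVERED through the bridge from
`ThetaQuotientFacts.ker_piThetaToEll_comm` (`Δ_Θ` is commutative, p. 12). [cite: MochizukiEtTh2009, §1 p.12] -/
theorem ker_thetaToEll_comm_of_bridge (e : D.OncePuncturedData) :
    ∀ x ∈ D.thetaToEll.ker, ∀ y ∈ D.thetaToEll.ker, x * y = y * x := by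
  intro x hx y hy
  have hx' : x ∈ (D.toOncePuncturedTemperedGroup e).piThetaToEll.ker.map
      (thetaQuotientEquiv e).toMonoidHom := by
    rw [map_thetaQuotientEquiv_ker]; exact hx
  have hy' : y ∈ (D.toOncePuncturedTemperedGroup e).piThetaToEll.ker.map
      (thetaQuotientEquiv e).toMonoidHom := by
    rw [map_thetaQuotientEquiv_ker]; exact hy
  obtain ⟨a, ha, rfl⟩ := hx'
  obtain ⟨b, hb, rfl⟩ := hy'
  change thetaQuotientEquiv e a * thetaQuotientEquiv e b = thetaQuotientEquiv e b * thetaQuotientEquiv e a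
  rw [← map_mul, ← map_mul, ThetaQuotientFacts.ker_piThetaToEll_comm _ a ha b hb]

end ThetaSetting

end Literature.AnabelianGeometry.EtaleTheta

end
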